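import Summits.Ventures.YMGap.RobustBall.MassGapOnBallS
import HarnessLib

/-!
# Venture YMGap, track ROBUST-BALL (tier 2) — the `ℓ¹`-exponential lattice sum on `ℤ^d`

HONEST FRAMING. WHAT THIS IS: a venture file (cell `pub-ymgap`, track Y2 ROBUST-BALL, seat rb-p1): elementary
lattice sums for the isotropic two-plaquette member `IsotropicPairWitness.lean`. With `l1 x = ∑_k |x_k|`
(`x ∈ ℤ^d`) and `0 ≤ r < 1`: every finite partial sum satisfies
`∑_{x ∈ F} r^{l1 (x - x₀)} ≤ ((1 + r)/(1 - r))^d` (`sum_pow_l1_sub_le`; product structure of the box and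
`∑_{m ∈ ℤ} r^{|m|} = (1 + r)/(1 - r)`), and `‖x‖_∞ ≤ l1 x`. WHAT IT IS NOT: no measure, no gauge field;
nothing about the continuum limit or the Clay problem.

References: folklore (geometric series).
-/

noncomputable section

open Filter Function Topology Real Finset
open Literature.Probability.LatticeModels

namespace Summit.Ventures.YMGap.RobustBall

variable {d : ℕ}

/-- The `ℓ¹` size of a lattice vector, as a natural number: `∑_k |x_k|`. -/
def l1 (x : Site d) : ℕ := ∑ k, (x k).natAbs

/-- `l1` is invariant under negation. -/
theorem l1_neg (x : Site d) : l1 (-x) = l1 x := by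
  simp [l1, Int.natAbs_neg]

/-- `l1 (x - y) = l1 (y - x)`. -/
theorem l1_sub_comm (x y : Site d) : l1 (x - y) = l1 (y - x) := by
  rw [← l1_neg, neg_sub]

/-- The sup norm is bounded by the `ℓ¹` size. -/
theorem norm_le_l1 (x : Site d) : ‖x‖ ≤ (l1 x : ℝ) := by
  refine (pi_norm_le_iff_of_nonneg (by positivity)).2 fun k => ?_
  rw [Int.norm_eq_abs, l1]
  push_cast
  have h : |((x k : ℤ) : ℝ)| = (((x k).natAbs : ℕ) : ℝ) := by
    rw [Nat.cast_natAbs, Int.cast_abs]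
  rw [h]
  exact Finset.single_le_sum (f := fun j => (((x j).natAbs : ℕ) : ℝ)) (fun j _ => by positivity) (mem_univ k)

/-! ### One dimension: `∑_{m ∈ T} r^{|m|} ≤ (1 + r)/(1 - r)` -/

/-- Nonnegative part: `∑_{m ∈ T, m ≥ 0} r^{|m|} ≤ 1/(1 - r)`. -/
theorem sum_pow_natAbs_nonneg_le {r : ℝ} (h0 : 0 ≤ r) (h1 : r < 1) (T : Finset ℤ) :
    ∑ m ∈ T.filter (fun m => 0 ≤ m), r ^ m.natAbs ≤ 1 / (1 - r) := by
  have hinj : Set.InjOn Int.natAbs ↑(T.filter fun m => 0 ≤ m) := by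
    intro m hm m' hm' h
    have hm0 : 0 ≤ m := (mem_filter.1 (Finset.mem_coe.1 hm)).2
    have hm0' : 0 ≤ m' := (mem_filter.1 (Finset.mem_coe.1 hm')).2
    exact Int.natAbs_inj_of_nonneg_of_nonneg hm0 hm0' |>.1 h
  rw [← Finset.sum_image (f := fun n : ℕ => r ^ n) hinj]
  calc ∑ n ∈ (T.filter fun m => 0 ≤ m).image Int.natAbs, r ^ n ≤ ∑' n : ℕ, r ^ n :=
        (summable_geometric_of_lt_one h0 h1).sum_le_tsum _ (fun n _ => pow_nonneg h0 n)
    _ = 1 / (1 - r) := by rw [tsum_geometric_of_lt_one h0 h1, one_div]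

/-- Negative part: `∑_{m ∈ T, m < 0} r^{|m|} ≤ r/(1 - r)` (here `|m| ≥ 1`). -/
theorem sum_pow_natAbs_neg_le {r : ℝ} (h0 : 0 ≤ r) (h1 : r < 1) (T : Finset ℤ) :
    ∑ m ∈ T.filter (fun m => ¬ 0 ≤ m), r ^ m.natAbs ≤ r / (1 - r) := by
  -- index the negative integers by `n = |m| - 1 ∈ ℕ`
  have hinj : Set.InjOn (fun m : ℤ => m.natAbs - 1) ↑(T.filter fun m => ¬ 0 ≤ m) := by
    intro m hm m' hm' h
    have hm0 : m < 0 := not_le.1 (mem_filter.1 (Finset.mem_coe.1 hm)).2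
    have hm0' : m' < 0 := not_le.1 (mem_filter.1 (Finset.mem_coe.1 hm')).2
    have h1m : 1 ≤ m.natAbs := Int.natAbs_pos.2 hm0.ne
    have h1m' : 1 ≤ m'.natAbs := Int.natAbs_pos.2 hm0'.ne
    have habs : m.natAbs = m'.natAbs := by simp only at h; omega
    exact (Int.natAbs_inj_of_nonpos_of_nonpos hm0.le hm0'.le).1 habs
  have hterm : ∀ m ∈ T.filter (fun m => ¬ 0 ≤ m), r ^ m.natAbs = r ^ ((m.natAbs - 1) + 1) := by
    intro m hm
    have hm0 : m < 0 := not_le.1 (mem_filter.1 hm).2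
    have h1m : 1 ≤ m.natAbs := Int.natAbs_pos.2 hm0.ne
    rw [Nat.sub_add_cancel h1m]
  rw [Finset.sum_congr rfl hterm, ← Finset.sum_image (f := fun n : ℕ => r ^ (n + 1)) hinj]
  have hs : Summable fun n : ℕ => r ^ (n + 1) := by
    simp_rw [pow_succ]; exact (summable_geometric_of_lt_one h0 h1).mul_right r
  calc ∑ n ∈ (T.filter fun m => ¬ 0 ≤ m).image (fun m : ℤ => m.natAbs - 1), r ^ (n + 1) ≤ ∑' n : ℕ, r ^ (n + 1) :=
        hs.sum_le_tsum _ (fun n _ => pow_nonneg h0 _)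
    _ = r / (1 - r) := by
        simp_rw [pow_succ]
        rw [tsum_mul_right, tsum_geometric_of_lt_one h0 h1, div_eq_inv_mul]

/-- **One-dimensional bound**: `∑_{m ∈ T} r^{|m|} ≤ (1 + r)/(1 - r)` for every finite `T ⊆ ℤ`. -/
theorem sum_pow_natAbs_le {r : ℝ} (h0 : 0 ≤ r) (h1 : r < 1) (T : Finset ℤ) :
    ∑ m ∈ T, r ^ m.natAbs ≤ (1 + r) / (1 - r) := by
  rw [← Finset.sum_filter_add_sum_filter_not T (fun m => 0 ≤ m)]
  have h1r : 0 < 1 - r := by linarith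
  calc _ ≤ 1 / (1 - r) + r / (1 - r) := add_le_add (sum_pow_natAbs_nonneg_le h0 h1 T) (sum_pow_natAbs_neg_le h0 h1 T)
    _ = (1 + r) / (1 - r) := by rw [← add_div]

/-! ### `d` dimensions: the box product -/

/-- On a box `∏_k T_k` the `ℓ¹`-exponential sum FACTORISES and is bounded by `((1 + r)/(1 - r))^d`. -/
theorem sum_piFinset_pow_l1_le {r : ℝ} (h0 : 0 ≤ r) (h1 : r < 1) (T : Fin d → Finset ℤ) :
    ∑ x ∈ Fintype.piFinset T, r ^ l1 x ≤ ((1 + r) / (1 - r)) ^ d := by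
  have hfac : ∑ x ∈ Fintype.piFinset T, r ^ l1 x = ∏ k : Fin d, ∑ m ∈ T k, r ^ m.natAbs := by
    rw [Finset.prod_univ_sum]
    refine Finset.sum_congr rfl fun x _ => ?_
    rw [l1, ← Finset.prod_pow_eq_pow_sum]
  rw [hfac]
  calc ∏ k : Fin d, ∑ m ∈ T k, r ^ m.natAbs ≤ ∏ _k : Fin d, (1 + r) / (1 - r) :=
        Finset.prod_le_prod (fun k _ => Finset.sum_nonneg fun m _ => pow_nonneg h0 _)
          fun k _ => sum_pow_natAbs_le h0 h1 (T k)
    _ = ((1 + r) / (1 - r)) ^ d := by rw [Finset.prod_const, Finset.card_univ, Fintype.card_fin]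

/-- **Every finite partial sum** of `r^{l1 x}` over `ℤ^d` is bounded by `((1 + r)/(1 - r))^d`. -/
theorem sum_pow_l1_le {r : ℝ} (h0 : 0 ≤ r) (h1 : r < 1) (F : Finset (Site d)) :
    ∑ x ∈ F, r ^ l1 x ≤ ((1 + r) / (1 - r)) ^ d := by
  classical
  -- put `F` in the box of its coordinate values
  set T : Fin d → Finset ℤ := fun k => F.image fun x => x k with hT
  have hsub : F ⊆ Fintype.piFinset T := fun x hx => Fintype.mem_piFinset.2 fun k => mem_image.2 ⟨x, hx, rfl⟩
  exact (Finset.sum_le_sum_of_subset_of_nonneg hsub fun x _ _ => pow_nonneg h0 _).trans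
    (sum_piFinset_pow_l1_le h0 h1 T)

/-- **Translated form**: `∑_{x ∈ F} r^{l1 (x₀ - x)} ≤ ((1 + r)/(1 - r))^d`. -/
theorem sum_pow_l1_sub_le {r : ℝ} (h0 : 0 ≤ r) (h1 : r < 1) (x₀ : Site d) (F : Finset (Site d)) :
    ∑ x ∈ F, r ^ l1 (x₀ - x) ≤ ((1 + r) / (1 - r)) ^ d := by
  classical
  have hinj : Set.InjOn (fun x : Site d => x₀ - x) ↑F := fun x _ y _ h => sub_right_injective h
  have h := sum_pow_l1_le h0 h1 (F.image fun x => x₀ - x)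
  rwa [Finset.sum_image hinj] at h

/-- Summability form: for every `x₀`, `x ↦ r^{l1 (x₀ - x)}` is summable over `ℤ^d` with sum
`≤ ((1 + r)/(1 - r))^d`. -/
theorem summable_pow_l1_sub {r : ℝ} (h0 : 0 ≤ r) (h1 : r < 1) (x₀ : Site d) :
    Summable (fun x : Site d => r ^ l1 (x₀ - x)) ∧ ∑' x : Site d, r ^ l1 (x₀ - x) ≤ ((1 + r) / (1 - r)) ^ d :=
  ⟨summable_of_sum_le (fun _ => pow_nonneg h0 _) (sum_pow_l1_sub_le h0 h1 x₀),
    Real.tsum_le_of_sum_le (fun _ => pow_nonneg h0 _) (sum_pow_l1_sub_le h0 h1 x₀)⟩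

end Summit.Ventures.YMGap.RobustBall
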